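import Summits.CriticalPhenomena.PercolationContinuityZ3.Theorems.Transplant.FKDoubleFanMultifanConeCross
import Summits.CriticalPhenomena.PercolationContinuityZ3.Theorems.Transplant.FKDoubleFanMultifanSignsCertA
import Summits.CriticalPhenomena.PercolationContinuityZ3.Theorems.Transplant.FKDoubleFanMultifanSignsCertB
import Summits.CriticalPhenomena.PercolationContinuityZ3.Theorems.Transplant.FKDoubleFanMultifanSignsCertC
import Summits.CriticalPhenomena.PercolationContinuityZ3.Theorems.Transplant.FKDoubleFanMultifanSignsCertD
import Summits.CriticalPhenomena.PercolationContinuityZ3.Theorems.Transplant.FKDoubleFanMultifanSignsCertE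
import Summits.CriticalPhenomena.PercolationContinuityZ3.Theorems.Transplant.FKDoubleFanMultifanSignsCertF
import Summits.CriticalPhenomena.PercolationContinuityZ3.Theorems.Transplant.FKDoubleFanMultifanSignsCertG
import Summits.CriticalPhenomena.PercolationContinuityZ3.Theorems.Transplant.FKDoubleFanOneSidedConeSSigns
import HarnessLib

/-!
# Double fans `K₂ ∨ P_{m+1}`: the sign orthant of the MULTIFAN₁ images (assembly) — the positivity functional of the MULTIFAN₁ cone and the
# exact local criterion `HypAC ⟺ CrossPosA` with its positivity hypothesis DISCHARGED

Helper file (`--supports stmt-CriticalPhenomena-4575`), FK sub-lane `prim-bschramm-fk-3` (gen 44); builds on p205010 (kernel theorem, internal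
audit signed; external expert review pending).  No named facts, no sorries; standard axioms.  Memo `bschramm/prim-bschramm-fk-3/FAR-CROSS-XIX.md` §2g.

`…MultifanSignsCertA–E` give the nine coordinate signs of `imgAB q F G u` over `Valid³` and `…CertF/G` the domination `|xy| ≤ uv`; hence
(**`norm_toFun_imgAB_le_sAB`**) the sup norm of a MULTIFAN₁ image is at most the signed coordinate sum **`sAB`**
`= ux + uy − uz + uv − xz + xv − yz + yv + zv`, which is the pairing with the explicit bivector **`e0AB q`** (**`pairH_e0AB`**, `q < 1`).  This is the
positivity functional `e₀` (with `c = 1`) of `hypAC_of_crossPosA` (`…MultifanConeCross`), so (**`hypAC_of_crossPosA'`**, **`hypAC_iff_crossPosA`**,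
`0 < q < 1`): `HypAC q` — and with it the far cross-apex theorem for all middles (**`negCorr_spokes_cross_far_of_crossPosA`**) — holds iff the
diagonal operator `T_a` is cross-positive on the compact closure `atomClosureAB q` of the normalised MULTIFAN₁ images against `DualAB q`.
[folklore]
-/

noncomputable section

namespace Summit.CriticalPhenomena.PercolationContinuityZ3.Theorems

namespace FK

namespace ThreeApex

/-- The signed coordinate sum of the MULTIFAN₁ sign orthant: `ux + uy − uz + uv − xz + xv − yz + yv + zv` (`xy` omitted). [folklore] -/
def sAB (β : Biv) : ℝ := β.ux + β.uy - β.uz + β.uv - β.xz + β.xv - β.yz + β.yv + β.zv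

/-- The bivector `e₀` with `⟪β, e₀⟫_H = sAB β` (`p = 1 − q ≠ 0`). [folklore] -/
def e0AB (q : ℝ) : Biv :=
  ⟨1 / ((1 - q) ^ 2 * (2 - q)), 1 / ((1 - q) ^ 2 * (2 - q)), -1 / ((1 - q) ^ 2 * (2 - q)), -1 / ((1 - q) * (2 - q)), 0,
    1 / (1 - q) ^ 2, 1 / (1 - q), 1 / (1 - q) ^ 2, 1 / (1 - q), 1 / (1 - q)⟩

/-- `⟪β, e0AB q⟫ = sAB β` (`q < 1`). [folklore] -/
theorem pairH_e0AB {q : ℝ} (hq1 : q < 1) (β : Biv) : pairH q β (e0AB q) = sAB β := by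
  have h1 : 1 - q ≠ 0 := by intro h; linarith
  have h2 : 2 - q ≠ 0 := by intro h; linarith
  simp only [pairH, e0AB, sAB]
  field_simp
  ring

/-- **The sup norm of a MULTIFAN₁ image is dominated by the signed sum**: `‖imgAB‖_∞ ≤ sAB (imgAB)` on `Valid³` (`0 ≤ q ≤ 1`). [folklore] -/
theorem norm_toFun_imgAB_le_sAB {q : ℝ} {F G u : V5} (hq0 : 0 ≤ q) (hq1 : q ≤ 1) (hF : Valid q F) (hG : Valid q G) (hu : Valid q u) :
    ‖Biv.toFun (imgAB q F G u)‖ ≤ sAB (imgAB q F G u) := by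
  have s1 := imgAB_ux_nonneg hq0 hq1 hF hG hu; have s2 := imgAB_uy_nonneg hq0 hq1 hF hG hu; have s3 := imgAB_uz_nonpos hq0 hq1 hF hG hu
  have s4 := imgAB_uv_nonneg hq0 hq1 hF hG hu; have s5 := imgAB_xz_nonpos hq0 hq1 hF hG hu; have s6 := imgAB_xv_nonneg hq0 hq1 hF hG hu
  have s7 := imgAB_yz_nonpos hq0 hq1 hF hG hu; have s8 := imgAB_yv_nonneg hq0 hq1 hF hG hu; have s9 := imgAB_zv_nonneg hq0 hq1 hF hG hu
  have b1 := imgAB_uv_sub_xy_nonneg hq0 hq1 hF hG hu; have b2 := imgAB_uv_add_xy_nonneg hq0 hq1 hF hG hu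
  have h : 0 ≤ sAB (imgAB q F G u) := by simp only [sAB]; linarith
  simp only [sAB] at *
  refine Biv.norm_toFun_le _ h ?_ ?_ ?_ ?_ ?_ ?_ ?_ ?_ ?_ ?_ <;> rw [abs_le] <;> constructor <;> linarith

/-- `e0AB` is uniformly positive on the MULTIFAN₁ images over `InKE³` (`c = 1`; `0 ≤ q < 1`). [folklore] -/
theorem hposAB_e0AB {q : ℝ} (hq0 : 0 ≤ q) (hq1 : q < 1) :
    ∀ F G u : V5, InKE q F → InKE q G → InKE q u → 1 * ‖Biv.toFun (imgAB q F G u)‖ ≤ pairH q (imgAB q F G u) (e0AB q) :=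
  fun F G u hF hG hu => by
    rw [one_mul, pairH_e0AB hq1]
    exact norm_toFun_imgAB_le_sAB hq0 hq1.le (hF.valid hq0 hq1.le) (hG.valid hq0 hq1.le) (hu.valid hq0 hq1.le)

/-- **`HypAC` from cross-positivity of `T_a` ALONE** (`0 < q < 1`). [folklore] -/
theorem hypAC_of_crossPosA' {q : ℝ} (hq0 : 0 < q) (hq1 : q < 1)
    (hcross : ∀ v ∈ atomClosureAB q, ∀ ρ : Biv, DualAB q ρ → pairH q (Biv.ofFun v) ρ = 0 → 0 ≤ pairH q (opTa (Biv.ofFun v)) ρ) :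
    HypAC q :=
  hypAC_of_crossPosA (e0AB q) one_pos (hposAB_e0AB hq0.le hq1) hcross

/-- **The exact local criterion**: `HypAC q ⟺` cross-positivity of `T_a` on `atomClosureAB q` against `DualAB q` (`0 < q < 1`). [folklore] -/
theorem hypAC_iff_crossPosA {q : ℝ} (hq0 : 0 < q) (hq1 : q < 1) :
    HypAC q ↔ ∀ v ∈ atomClosureAB q, ∀ ρ : Biv, DualAB q ρ → pairH q (Biv.ofFun v) ρ = 0 → 0 ≤ pairH q (opTa (Biv.ofFun v)) ρ :=
  ⟨crossPosA_of_hypAC, hypAC_of_crossPosA' hq0 hq1⟩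

open MeasureTheory Literature.Probability.LatticeModels Literature.Probability.Percolation
open scoped Classical

variable {V : Type*} [Fintype V]

section Setting

variable {a b : V} {c : ℕ → V} {m : ℕ}
variable (hab : a ≠ b) (hinj : ∀ j k, j ≤ m → k ≤ m → c j = c k → j = k) (hca : ∀ j, j ≤ m → c j ≠ a) (hcb : ∀ j, j ≤ m → c j ≠ b)
include hab hinj hca hcb

/-- **Cross-positivity of `T_a` on the MULTIFAN₁ cone ⟹ negative correlation of every cross-apex pair at every distance** (`0 < q < 1`). [folklore] -/
theorem negCorr_spokes_cross_far_of_crossPosA (hcard : Fintype.card V = m + 3) {q : ℝ} (hq0 : 0 < q) (hq1 : q < 1)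
    (w : Sym2 V → unitInterval) (hsupp : ∀ e, e ∉ dfPairs a b c m → w e = 0)
    (hcross : ∀ v ∈ atomClosureAB q, ∀ ρ : Biv, DualAB q ρ → pairH q (Biv.ofFun v) ρ = 0 → 0 ≤ pairH q (opTa (Biv.ofFun v)) ρ)
    {j k : ℕ} (hjk : j < k) (hk : k ≤ m) :
    (rcMeasureW w q ∅).real ({ω : BondConfig V | s(a, c j) ∈ ω} ∩ {ω | s(b, c k) ∈ ω}) ≤
      (rcMeasureW w q ∅).real {ω : BondConfig V | s(a, c j) ∈ ω} * (rcMeasureW w q ∅).real {ω : BondConfig V | s(b, c k) ∈ ω} :=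
  negCorr_spokes_cross_far_of_hypAC hab hinj hca hcb hcard hq0 hq1.le w hsupp (hypAC_of_crossPosA' hq0 hq1 hcross) hjk hk

end Setting

end ThreeApex

end FK

end Summit.CriticalPhenomena.PercolationContinuityZ3.Theorems
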